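import Summits.ResolutionOfSingularities.ResolutionOfSingularities.Theorems.PurelyInseparableDim4ChartAtlasSNCFarRepairPairs
import HarnessLib

/-!
# Purely inseparable four-folds `z^p + F(x₁, …, x₄)`: THE FAR-RESONANCE REPAIR IN THE CHART'S NATURAL FRAME — the far alphabet of PA1–PA3c
# (`Q_{(i,d)} = ((yᵢ + bᵢ)·y_j + d)·𝒪`), any finite set of non-zero resonant heights (cell `res-dim4-pi`, typ-2 g7; HANDOFF OPEN 2/6 in the
# currency of the pair-list packages)

[OURS · counted 0] (D-0157 DOOR 2; DR-157-C.) R1–R5 were typed in R1's TRANSLATED frame `y_j ↦ y_j − c′` (first resonant height moved to `0`,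
exceptional hyperplane `E_j` at `y_j = c′ ≠ 0`; far members `TQ_k = ((y_k + b_k)·y_j − c′·y_k + e_k)·𝒪`). The many-heights repair
(p718376 / `…SNCFarRepairPairs`) needs no resonance at `0`, so it applies VERBATIM in the chart's NATURAL frame `c′ = 0`, where the far
members are the quadrics `Q_{(i,d)} = ((yᵢ + bᵢ)·y_j + d)·𝒪`, `(i, d) ∈ FQ`, `i ≠ j`, `d ≠ 0`, of p709429 (`…SNCFarChartPairs`, the reading of
the far member `{xᵢ = −d}` on the re-centred `x_j`-chart, p703421), the exceptional component `E_j` is the hyperplane `y_j` (height `0`), and a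
far member `(i, d)` with `i ∈ T` resonates with the escaping centre `Zc = V(y_0, y_T)` at the height `h ≠ 0` with `d + bᵢ h = 0`. PROVED here
(no `sorry`, no new axiom):

* `forall_mem_tquadric_zero_of_quadric_shape` — the PA1 alphabet is the `TQ` alphabet with `c′ = 0` (`(yᵢ + bᵢ)·y_j − 0·yᵢ + d`);
* `hasSNCWith_prod_heights_natural` — the natural-frame boundary is snc with the repair centre `C(hs) = Π_{h ∈ hs} ψ_{−h}^*𝓘(V(y_0, y_T, y_j))`
  (pairwise distinct NON-ZERO heights; with `isRegular_subscheme_prod_heights` / `support_prod_heights_subset` of p718376 the centre is admissible);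
* **`admissible_strictTransform_after_farRepair_heights`** — for ANY blowing up `π` of `𝔸⁵` along `C(hs)`: `St_π(Zc)` is REGULAR, inside
  `supp(((z^p + F)·𝒪, E, p).transform π C(hs))`, and snc with the transformed boundary, under p709429's provenance hypotheses `hFQ`, `hC1` and
  its height hypotheses `hC2`/`hC3` asked only OFF the heights of `hs` (exactly the members violating p704073's `hH1`/`hH2` are repaired).

WORDS: «in the chart of the walk itself: list the non-zero heights at which active far members resonate (with each other or with an index-`j` far
hyperplane); ONE blow-up along the disjoint union of the loci `Zc ∩ {y_j = h}` makes the strict transform of the escaping centre admissible».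
Nothing here is a statement about resolution of singularities in dimension ≥ 4 / characteristic `p` (NOT proved anywhere in this programme).
bears_on: LADDER-RESOLUTION:D157-DOOR2 (res-dim4-pi). Supports stmt-ResolutionOfSingularities-16155 (helper).
-/

-- every declaration of this summit lives under `Summit.ResolutionOfSingularities.ResolutionOfSingularities`
-- (summit = problem), which the duplicate-namespace linter flags; house convention (cf. the Target file).
set_option linter.dupNamespace false

noncomputable section

open MvPolynomial CategoryTheory AlgebraicGeometry TopologicalSpace
open AlgebraicGeometry.Scheme.IdealSheafData (ofIdealTop)

namespace Summit.ResolutionOfSingularities.ResolutionOfSingularities.Theorems.PIDim4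

open Literature.AlgebraicGeometry.Resolution
open Literature.AlgebraicGeometry.Resolution.AffinePointBlowup (P A γ)

namespace ChartDictionary

variable {K : Type} [Field K] {p : ℕ} {T : Finset (Fin 4)} {j : Fin 4} {b : Fin 4 → K}

/-- **The PA1 far alphabet is the `TQ` alphabet with `c′ = 0`**: a boundary in the shapes `⊤` / `(y_m + a)·𝒪` / `((yᵢ + bᵢ)·y_j + d)·𝒪` is a
boundary in the shapes `⊤` / `(y_m + a)·𝒪` / `((yᵢ + bᵢ)·y_j − 0·yᵢ + d)·𝒪`. -/
theorem forall_mem_tquadric_zero_of_quadric_shape (H₀ : Finset (Fin (4 + 1) × K)) (FQ : Finset (Fin 4 × K))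
    {E : List (Scheme.IdealSheafData (P 4 K))}
    (hE : ∀ D ∈ E, D = ⊤ ∨ (∃ ma ∈ H₀, D = ofIdealTop (Ideal.span {(γ 4 K).symm (X ma.1 + C ma.2)})) ∨
      ∃ id ∈ FQ, D = ofIdealTop (Ideal.span {(γ 4 K).symm ((X id.1.succ + C (b id.1)) * X j.succ + C id.2)})) :
    ∀ D ∈ E, D = ⊤ ∨ (∃ ma ∈ H₀, D = ofIdealTop (Ideal.span {(γ 4 K).symm (X ma.1 + C ma.2)})) ∨
      ∃ kε ∈ FQ, D = ofIdealTop (Ideal.span {(γ 4 K).symm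
        ((X kε.1.succ + C (b kε.1)) * X j.succ - C (0 : K) * X kε.1.succ + C kε.2)}) := by
  intro D hD
  rcases hE D hD with h | h | ⟨id, hid, h⟩
  · exact Or.inl h
  · exact Or.inr (Or.inl h)
  · refine Or.inr (Or.inr ⟨id, hid, ?_⟩)
    rw [h, C_0, zero_mul, sub_zero]

/-- **THE NATURAL-FRAME BOUNDARY IS SNC WITH THE REPAIR CENTRE `C(hs)`** (pairwise distinct non-zero heights `hs ≠ []`; far members `(i, d) ∈ FQ`
with `i ≠ j`, `d ≠ 0`, provenance `hC1`). -/
theorem hasSNCWith_prod_heights_natural (hjT : j ∉ T) (hs : List K) (hne : hs ≠ []) (hnd : hs.Nodup) (h0 : ∀ h ∈ hs, h ≠ 0)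
    (H₀ : Finset (Fin (4 + 1) × K)) (FQ : Finset (Fin 4 × K)) (hFQ : ∀ id ∈ FQ, id.1 ≠ j ∧ id.2 ≠ 0)
    (hC1 : ∀ id ∈ FQ, ∀ a : K, (id.1.succ, a) ∈ H₀ → a = b id.1) {E : List (Scheme.IdealSheafData (P 4 K))}
    (hE : ∀ D ∈ E, D = ⊤ ∨ (∃ ma ∈ H₀, D = ofIdealTop (Ideal.span {(γ 4 K).symm (X ma.1 + C ma.2)})) ∨
      ∃ id ∈ FQ, D = ofIdealTop (Ideal.span {(γ 4 K).symm ((X id.1.succ + C (b id.1)) * X j.succ + C id.2)})) :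
    HasSNCWith E (hs.map fun h => (AffineCoordBlowup.𝓘Λ 4 K (insert 0 (Fin.succ '' ((insert j T : Finset (Fin 4)) : Set (Fin 4))))).comap
      (Spec.map (CommRingCat.ofHom ((AffinePointBlowup.translateEquiv (n := 4) (Pi.single j.succ (-h)) : A 4 K ≃ₐ[K] A 4 K) :
        A 4 K →+* A 4 K)))).prod :=
  hasSNCWith_prod_heights_pairs (b := b) (c' := 0) hjT hs hne hnd (fun h hh => by rw [zero_sub, neg_ne_zero]; exact h0 h hh) H₀ FQ
    (fun id hid => (hFQ id hid).1) (fun id hid => by rw [mul_zero, add_zero]; exact (hFQ id hid).2) hC1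
    (forall_mem_tquadric_zero_of_quadric_shape H₀ FQ hE)

/-- **THE FAR-RESONANCE REPAIR IN THE CHART'S NATURAL FRAME, ANY FINITE SET OF NON-ZERO HEIGHTS.** `j ∉ T`; boundary: hyperplanes `(m, a) ∈ H₀`
(the exceptional component `y_j = (j⁺, 0)`, near members, transversal members, index-`j` far hyperplanes `y_j + d`) and far quadrics
`Q_{(i,d)} = ((yᵢ + bᵢ)·y_j + d)·𝒪`, `(i, d) ∈ FQ` (`i ≠ j`, `d ≠ 0`, provenance `hC1`); the height hypotheses `hC2` (index-`j` hyperplane vs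
active quadric) and `hC3` (two active quadrics of different indices) of p709429 are asked only OFF the heights `hs`. Then for ANY blowing up `π`
of `𝔸⁵` along `C(hs) = Π_{h ∈ hs} ψ_{−h}^*𝓘(V(y_0, y_T, y_j))`: `St_π(V(y_0, y_T))` is REGULAR, inside `supp(((z^p + F)·𝒪, E, p).transform π C(hs))`
(`z^p + F` `T`-permissible, `T ≠ ∅`), and snc with the transformed boundary. -/
theorem admissible_strictTransform_after_farRepair_heights (hjT : j ∉ T) (hs : List K) (hne : hs ≠ []) (hnd : hs.Nodup)
    (h0 : ∀ h ∈ hs, h ≠ 0) (H₀ : Finset (Fin (4 + 1) × K)) (FQ : Finset (Fin 4 × K)) (hFQ : ∀ id ∈ FQ, id.1 ≠ j ∧ id.2 ≠ 0)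
    (hC1 : ∀ id ∈ FQ, ∀ a : K, (id.1.succ, a) ∈ H₀ → a = b id.1)
    (hC2 : ∀ a : K, (j.succ, a) ∈ H₀ → (∀ h ∈ hs, a + h ≠ 0) →
      ∀ id ∈ FQ, id.1 ∈ T → (∀ h ∈ hs, id.2 + b id.1 * h ≠ 0) → b id.1 ≠ 0 → id.2 ≠ a * b id.1)
    (hC3 : ∀ id ∈ FQ, ∀ kd ∈ FQ, id.1 ∈ T → kd.1 ∈ T → (∀ h ∈ hs, id.2 + b id.1 * h ≠ 0) →
      (∀ h ∈ hs, kd.2 + b kd.1 * h ≠ 0) → id.1 ≠ kd.1 → b id.1 ≠ 0 → b kd.1 ≠ 0 → id.2 * b kd.1 ≠ kd.2 * b id.1)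
    {k₀ : Fin 4} (hk₀ : k₀ ∈ T) {E : List (Scheme.IdealSheafData (P 4 K))}
    (hE : ∀ D ∈ E, D = ⊤ ∨ (∃ ma ∈ H₀, D = ofIdealTop (Ideal.span {(γ 4 K).symm (X ma.1 + C ma.2)})) ∨
      ∃ id ∈ FQ, D = ofIdealTop (Ideal.span {(γ 4 K).symm ((X id.1.succ + C (b id.1)) * X j.succ + C id.2)}))
    (F : MvPolynomial (Fin 4) K) (hperm : (p : ℕ∞) ≤ CentreBlowup.ordAlong T F) {W : Scheme.{0}} {π : W ⟶ P 4 K}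
    (hπ : IsBlowup π (hs.map fun h => (AffineCoordBlowup.𝓘Λ 4 K (insert 0 (Fin.succ '' ((insert j T : Finset (Fin 4)) : Set (Fin 4))))).comap
      (Spec.map (CommRingCat.ofHom ((AffinePointBlowup.translateEquiv (n := 4) (Pi.single j.succ (-h)) : A 4 K ≃ₐ[K] A 4 K) :
        A 4 K →+* A 4 K)))).prod) :
    let Cn := (hs.map fun h => (AffineCoordBlowup.𝓘Λ 4 K (insert 0 (Fin.succ '' ((insert j T : Finset (Fin 4)) : Set (Fin 4))))).comap
      (Spec.map (CommRingCat.ofHom ((AffinePointBlowup.translateEquiv (n := 4) (Pi.single j.succ (-h)) : A 4 K ≃ₐ[K] A 4 K) :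
        A 4 K →+* A 4 K)))).prod
    let M' := (⟨hypSheaf p F, E, p⟩ : MarkedIdeal (P 4 K)).transform π Cn
    let C' := strictTransformIdeal π Cn (AffineCoordBlowup.𝓘Λ 4 K (insert 0 (Fin.succ '' (T : Set (Fin 4)))))
    Scheme.IsRegular C'.subscheme ∧ (C'.support : Set W) ⊆ M'.support ∧ HasSNCWith M'.boundary C' :=
  admissible_strictTransform_after_manyHeights_farRepair_pairs (b := b) (c' := 0) hjT hs hne hnd
    (fun h hh => by rw [zero_sub, neg_ne_zero]; exact h0 h hh) H₀ FQ (fun id hid => (hFQ id hid).1)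
    (fun id hid => by rw [mul_zero, add_zero]; exact (hFQ id hid).2) hC1 hC2 hC3 hk₀
    (forall_mem_tquadric_zero_of_quadric_shape H₀ FQ hE) F hperm hπ

end ChartDictionary

end Summit.ResolutionOfSingularities.ResolutionOfSingularities.Theorems.PIDim4

end
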